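import Literature.Analysis.Calculus.JacobianNullLagrangian
import Mathlib.Analysis.InnerProductSpace.Adjoint
import Mathlib.Analysis.Calculus.Deriv.Comp
import Mathlib.Analysis.Calculus.MeanValue
import Mathlib.LinearAlgebra.Trace
import Mathlib.LinearAlgebra.Matrix.Trace
import Mathlib.Topology.Algebra.Module.Determinant
import HarnessLib

/-!
# Liouville's formula for a linear matrix ODE in `ℝ³`: `A' = B A`, `tr B = 0` ⇒ `det A` constant

Topic `Literature/Analysis/Calculus`. The evolution of the Jacobian determinant along particle
trajectories (A. J. Majda, A. L. Bertozzi, *Vorticity and Incompressible Flow*, CUP 2002, §1.3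
**Prop. 1.2**, p. 13–14 of the held text: "`∂J/∂t = (div_x v)|_{(X(α,t),t)} J(α, t)`",
`J = det ∇_αX`, proved there from the cofactor expansion
`∂ₜ det [∂Xⁱ/∂αⱼ] = Σ Aʲᵢ ∂ₜ ∂Xⁱ/∂αⱼ` and `Σⱼ ∂Xᵏ/∂αⱼ Aʲᵢ = δᵏᵢ J`) rests on the linear
algebra of **Jacobi's formula**: along a differentiable curve of operators `A(t)` on `ℝ³` with
`A'(t) = B(t) A(t)`, `(det A)' = tr B(t) · det A(t)`; in particular `det A` is constant when
`tr B ≡ 0` (Liouville/Abel; Majda–Bertozzi Prop. 1.4 (ii) ⇒ (iii), "`div v = 0`" ⇒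
"`J(α, t) = 1`"). This file proves these statements for curves differentiable *within a convex
set of times* (so that they apply on closed intervals `[a, b]` with one-sided derivatives at the
endpoints, the setting of the tree's volume-preservation fact
`Literature.Analysis.FluidPDE.MajdaBertozzi2002_particleTrajectory_volumePreserving`,
`FluidPDE/HolderEulerTrajectoryContinuation.lean`):

* `hasDerivWithinAt_det_rows` / `hasDerivAt_det_rows` — the determinant of a differentiable curve
  of frames `m : ℝ → (ι → ι → ℝ)` has derivative `Σⱼ det (update (m t) j (m' j))` (Mathlib's
  derivative of a continuous multilinear map, `ContinuousMultilinearMap.hasFDerivAt`, for the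
  tree's `detRowsCLM`), any finite `ι`;
* `sum_det_of_update_mulVec` — the trace identity in `ℝ³`:
  `Σⱼ det (…, B mⱼ, …) = tr B · det (m₀, m₁, m₂)` (a polynomial identity, checked by `ring`;
  the general-`ι` form is generalisation debt — it is the adjugate identity `Σⱼ Xᵏⱼ Aʲᵢ = δᵏᵢ J`,
  Mathlib `Matrix.mul_adjugate` / the tree's `jacCofactor_eq_adjugate`);
* `frameCLM` — the columns `(L eⱼ)ᵢ` of an operator on `EuclideanSpace ℝ ι` as a continuous
  linear map into `ι → ι → ℝ`, with `det (of (frameCLM L)) = det L` (`det_of_frameCLM`) and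
  `frameCLM (B ∘ L) j = [B] *ᵥ frameCLM L j` (`frameCLM_comp_apply`), where `[B]` is Mathlib's
  standard matrix `LinearMap.toMatrixOrthonormal (EuclideanSpace.basisFun ι ℝ) B`, of trace
  `tr B` (`trace_toMatrixOrthonormal_basisFun`);
* `hasDerivWithinAt_det_of_hasDerivWithinAt_clm_comp` — **Jacobi** for operator curves on `ℝ³`:
  `A' = B ∘ A(t)` within `s` at `t` ⇒ `(det A)' = tr B · det A(t)` within `s` at `t`;
* `det_eq_det_of_hasDerivWithinAt_comp_of_trace_eq_zero` — **Liouville** on a convex set of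
  times (and the open-interval corollary `det_eq_det_of_hasDerivAt_comp_of_trace_eq_zero`).

Mathlib has `Matrix.det_one_add_smul` (the derivative of `det` at `1` is the trace) but no
derivative of the determinant along a curve and no Liouville formula
(`lean search 'hasDerivAt.*det|det.*hasDerivAt|liouville'`). In the tree, two `FluidPDE` files
carry `3 × 3` in-file versions of Jacobi's formula for their own use — `BDSV.hasFDerivAt_det`
(`OnsagerBDSVFlowJacobian.lean`, adjugate form, inside the Onsager/BDSV import closure) and
`hasDerivWithinAt_det_of_hasDerivWithinAt_comp` (`HolderEulerVolumePreserving.lean`, by the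
explicit cubic); this file is the import-light `Calculus/` form over general frames, reusing
`detRowsCLM` of `JacobianNullLagrangian.lean`.

## References

* A. J. Majda, A. L. Bertozzi, *Vorticity and Incompressible Flow* (CUP 2002), §1.3 Prop. 1.2,
  (1.14)–(1.15), Prop. 1.4, p. 13–14. [MajdaBertozziCUP2002]
-/

noncomputable section

open Function Set
open scoped Matrix InnerProductSpace

namespace Literature.Analysis.Calculus

/-! ### Jacobi's formula along a curve of frames -/

/-- **Jacobi's formula along a curve, within a set of times**: if the frame
`m : ℝ → (ι → ι → ℝ)` has derivative `m'` at `t` within `s`, then `u ↦ det (m u)` has derivative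
`Σⱼ det (update (m t) j (m' j))` at `t` within `s` (the determinant is multilinear in the rows;
Majda–Bertozzi, proof of Prop. 1.2: "Because the determinant is multilinear in columns (rows),
we compute the time derivative …"). [cite: MajdaBertozziCUP2002, §1.3 proof of Prop. 1.2 (p. 14)] -/
theorem hasDerivWithinAt_det_rows {ι : Type*} [Fintype ι] [DecidableEq ι] {m : ℝ → ι → ι → ℝ}
    {m' : ι → ι → ℝ} {s : Set ℝ} {t : ℝ} (hm : HasDerivWithinAt m m' s t) :
    HasDerivWithinAt (fun u => (Matrix.of (m u)).det)
      (∑ j, (Matrix.of (update (m t) j (m' j))).det) s t := by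
  have h := ((detRowsCLM ι).hasFDerivAt (m t)).comp_hasDerivWithinAt t hm
  rw [ContinuousMultilinearMap.linearDeriv_apply] at h
  exact h

/-- **Jacobi's formula along a curve**: the two-sided version of `hasDerivWithinAt_det_rows`. [cite: MajdaBertozziCUP2002, §1.3 proof of Prop. 1.2 (p. 14)] -/
theorem hasDerivAt_det_rows {ι : Type*} [Fintype ι] [DecidableEq ι] {m : ℝ → ι → ι → ℝ}
    {m' : ι → ι → ℝ} {t : ℝ} (hm : HasDerivAt m m' t) :
    HasDerivAt (fun u => (Matrix.of (m u)).det)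
      (∑ j, (Matrix.of (update (m t) j (m' j))).det) t := by
  have h := ((detRowsCLM ι).hasFDerivAt (m t)).comp_hasDerivAt t hm
  rw [ContinuousMultilinearMap.linearDeriv_apply] at h
  exact h

/-- **The trace identity in `ℝ³`**: for a frame `m = (m₀, m₁, m₂)` and a matrix `B`,
`Σⱼ det (m with mⱼ replaced by B mⱼ) = tr B · det m` — the derivative of `det` at `m` in the
direction `(B m₀, B m₁, B m₂)`; with Jacobi's formula this is `(det A)' = tr B · det A` for
`A' = B A` (Majda–Bertozzi (1.15) with the identity "`Σⱼ ∂Xᵏ/∂αⱼ Aʲᵢ = δᵏᵢ J`"). A polynomial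
identity in the `18` entries, verified by `ring`. [cite: MajdaBertozziCUP2002, §1.3 proof of Prop. 1.2 (p. 14)] -/
theorem sum_det_of_update_mulVec (m : Fin 3 → Fin 3 → ℝ) (B : Matrix (Fin 3) (Fin 3) ℝ) :
    ∑ j, (Matrix.of (update m j (B *ᵥ m j))).det = B.trace * (Matrix.of m).det := by
  simp only [Fin.sum_univ_three, Matrix.det_fin_three, Matrix.of_apply, Matrix.trace_fin_three,
    update_apply, Fin.isValue, Fin.reduceEq, if_true, if_false, Matrix.mulVec, dotProduct]
  ring

/-! ### Operators on `EuclideanSpace ℝ ι` as frames -/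

section Frame

variable (ι : Type*) [Fintype ι] [DecidableEq ι]

/-- **The frame of an operator**: `frameCLM L j i = (L eⱼ)ᵢ`, the columns of the matrix of
`L : EuclideanSpace ℝ ι →L EuclideanSpace ℝ ι` in the standard basis, as a continuous linear map
into `ι → ι → ℝ` (so that derivatives of operator-valued curves pass to their frames). [folklore] -/
def frameCLM : (EuclideanSpace ℝ ι →L[ℝ] EuclideanSpace ℝ ι) →L[ℝ] (ι → ι → ℝ) :=
  ContinuousLinearMap.pi fun j =>
    (EuclideanSpace.equiv ι ℝ : EuclideanSpace ℝ ι →L[ℝ] ι → ℝ).comp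
      (ContinuousLinearMap.apply ℝ (EuclideanSpace ℝ ι) (EuclideanSpace.single j (1 : ℝ)))

variable {ι}

/-- Entries of the frame. [folklore] -/
@[simp]
theorem frameCLM_apply (L : EuclideanSpace ℝ ι →L[ℝ] EuclideanSpace ℝ ι) (j i : ι) :
    frameCLM ι L j i = L (EuclideanSpace.single j (1 : ℝ)) i := rfl

/-- Entries of Mathlib's standard matrix of an operator on `EuclideanSpace ℝ ι`
(`LinearMap.toMatrixOrthonormal` in the basis `EuclideanSpace.basisFun`): `[L]ᵢₖ = (L eₖ)ᵢ`. [folklore] -/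
@[simp]
theorem toMatrixOrthonormal_basisFun_apply (L : EuclideanSpace ℝ ι →L[ℝ] EuclideanSpace ℝ ι)
    (i k : ι) :
    LinearMap.toMatrixOrthonormal (EuclideanSpace.basisFun ι ℝ)
        (L : EuclideanSpace ℝ ι →ₗ[ℝ] EuclideanSpace ℝ ι) i k =
      L (EuclideanSpace.single k (1 : ℝ)) i := by
  rw [LinearMap.toMatrixOrthonormal_apply_apply, EuclideanSpace.basisFun_apply,
    EuclideanSpace.basisFun_apply, EuclideanSpace.inner_single_left, map_one, one_mul,
    ContinuousLinearMap.coe_coe]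

/-- The standard matrix in the orthonormal standard basis is the matrix in the underlying basis
(definitional). [folklore] -/
theorem toMatrixOrthonormal_basisFun_eq_toMatrix
    (L : EuclideanSpace ℝ ι →L[ℝ] EuclideanSpace ℝ ι) :
    LinearMap.toMatrixOrthonormal (EuclideanSpace.basisFun ι ℝ)
        (L : EuclideanSpace ℝ ι →ₗ[ℝ] EuclideanSpace ℝ ι) =
      LinearMap.toMatrix (EuclideanSpace.basisFun ι ℝ).toBasis (EuclideanSpace.basisFun ι ℝ).toBasis
        (L : EuclideanSpace ℝ ι →ₗ[ℝ] EuclideanSpace ℝ ι) := rfl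

/-- The frame is the transpose of the standard matrix. [folklore] -/
theorem of_frameCLM (L : EuclideanSpace ℝ ι →L[ℝ] EuclideanSpace ℝ ι) :
    Matrix.of (frameCLM ι L) =
      (LinearMap.toMatrixOrthonormal (EuclideanSpace.basisFun ι ℝ)
        (L : EuclideanSpace ℝ ι →ₗ[ℝ] EuclideanSpace ℝ ι))ᵀ := by
  ext j i
  rw [Matrix.of_apply, frameCLM_apply, Matrix.transpose_apply, toMatrixOrthonormal_basisFun_apply]

/-- **`det` of the frame is `det` of the operator.** [folklore] -/
theorem det_of_frameCLM (L : EuclideanSpace ℝ ι →L[ℝ] EuclideanSpace ℝ ι) :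
    (Matrix.of (frameCLM ι L)).det = L.det := by
  rw [of_frameCLM, Matrix.det_transpose, toMatrixOrthonormal_basisFun_eq_toMatrix,
    LinearMap.det_toMatrix]

/-- **The trace of the standard matrix is the trace of the operator.** [folklore] -/
theorem trace_toMatrixOrthonormal_basisFun (L : EuclideanSpace ℝ ι →L[ℝ] EuclideanSpace ℝ ι) :
    (LinearMap.toMatrixOrthonormal (EuclideanSpace.basisFun ι ℝ)
        (L : EuclideanSpace ℝ ι →ₗ[ℝ] EuclideanSpace ℝ ι)).trace =
      LinearMap.trace ℝ (EuclideanSpace ℝ ι) (L : EuclideanSpace ℝ ι →ₗ[ℝ] EuclideanSpace ℝ ι) := by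
  rw [toMatrixOrthonormal_basisFun_eq_toMatrix, ← LinearMap.trace_eq_matrix_trace]

/-- Coordinates of `L w`: `(L w)ᵢ = Σₖ [L]ᵢₖ wₖ`, i.e. `L w = [L] *ᵥ w` in coordinates. [folklore] -/
theorem apply_apply_eq_toMatrixOrthonormal_mulVec
    (L : EuclideanSpace ℝ ι →L[ℝ] EuclideanSpace ℝ ι) (w : EuclideanSpace ℝ ι) (i : ι) :
    L w i = (LinearMap.toMatrixOrthonormal (EuclideanSpace.basisFun ι ℝ)
      (L : EuclideanSpace ℝ ι →ₗ[ℝ] EuclideanSpace ℝ ι) *ᵥ (fun k => w k)) i := by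
  have hw : w = ∑ k, w k • EuclideanSpace.single k (1 : ℝ) := by
    conv_lhs => rw [← (EuclideanSpace.basisFun ι ℝ).sum_repr w]
    simp [EuclideanSpace.basisFun_apply]
  conv_lhs => rw [hw]
  rw [map_sum, WithLp.ofLp_sum, Finset.sum_apply]
  simp only [map_smul, WithLp.ofLp_smul, Pi.smul_apply, smul_eq_mul, Matrix.mulVec, dotProduct,
    toMatrixOrthonormal_basisFun_apply]
  exact Finset.sum_congr rfl fun k _ => mul_comm _ _

/-- **Frames of a composition**: `frameCLM (B ∘ L) j = [B] *ᵥ frameCLM L j`. [folklore] -/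
theorem frameCLM_comp_apply (B L : EuclideanSpace ℝ ι →L[ℝ] EuclideanSpace ℝ ι) (j : ι) :
    frameCLM ι (B.comp L) j =
      LinearMap.toMatrixOrthonormal (EuclideanSpace.basisFun ι ℝ)
        (B : EuclideanSpace ℝ ι →ₗ[ℝ] EuclideanSpace ℝ ι) *ᵥ frameCLM ι L j := by
  funext i
  rw [frameCLM_apply, ContinuousLinearMap.comp_apply, apply_apply_eq_toMatrixOrthonormal_mulVec]
  rfl

end Frame

/-! ### Jacobi's and Liouville's formulas for operator curves on `ℝ³` -/

/-- **Jacobi's formula for operators on `ℝ³`, within a set of times**: if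
`A : ℝ → (ℝ³ →L ℝ³)` has derivative `B ∘ A(t)` at `t` within `s`, then `det A` has derivative
`tr B · det A(t)` at `t` within `s` (Majda–Bertozzi (1.15), `∂ₜJ = (div v) J`, in operator
form). [cite: MajdaBertozziCUP2002, §1.3 Prop. 1.2 (1.15) (p. 13–14)] -/
theorem hasDerivWithinAt_det_of_hasDerivWithinAt_clm_comp
    {A : ℝ → (EuclideanSpace ℝ (Fin 3) →L[ℝ] EuclideanSpace ℝ (Fin 3))}
    {B : EuclideanSpace ℝ (Fin 3) →L[ℝ] EuclideanSpace ℝ (Fin 3)} {s : Set ℝ} {t : ℝ}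
    (hA : HasDerivWithinAt A (B.comp (A t)) s t) :
    HasDerivWithinAt (fun u => (A u).det)
      (LinearMap.trace ℝ (EuclideanSpace ℝ (Fin 3))
          (B : EuclideanSpace ℝ (Fin 3) →ₗ[ℝ] EuclideanSpace ℝ (Fin 3)) * (A t).det) s t := by
  have hm : HasDerivWithinAt (fun u => frameCLM (Fin 3) (A u)) (frameCLM (Fin 3) (B.comp (A t)))
      s t :=
    (frameCLM (Fin 3)).hasFDerivAt.comp_hasDerivWithinAt t hA
  have h := hasDerivWithinAt_det_rows hm
  have hsum : ∑ j, (Matrix.of (update (frameCLM (Fin 3) (A t)) j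
      (frameCLM (Fin 3) (B.comp (A t)) j))).det =
      LinearMap.trace ℝ (EuclideanSpace ℝ (Fin 3))
        (B : EuclideanSpace ℝ (Fin 3) →ₗ[ℝ] EuclideanSpace ℝ (Fin 3)) * (A t).det := by
    simp_rw [frameCLM_comp_apply]
    rw [sum_det_of_update_mulVec, trace_toMatrixOrthonormal_basisFun, det_of_frameCLM]
  rw [hsum] at h
  simp_rw [det_of_frameCLM] at h
  exact h

/-- **Jacobi's formula for operators on `ℝ³`**: the two-sided version of
`hasDerivWithinAt_det_of_hasDerivWithinAt_clm_comp`. [cite: MajdaBertozziCUP2002, §1.3 Prop. 1.2 (1.15) (p. 13–14)] -/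
theorem hasDerivAt_det_of_hasDerivAt_clm_comp
    {A : ℝ → (EuclideanSpace ℝ (Fin 3) →L[ℝ] EuclideanSpace ℝ (Fin 3))}
    {B : EuclideanSpace ℝ (Fin 3) →L[ℝ] EuclideanSpace ℝ (Fin 3)} {t : ℝ}
    (hA : HasDerivAt A (B.comp (A t)) t) :
    HasDerivAt (fun u => (A u).det)
      (LinearMap.trace ℝ (EuclideanSpace ℝ (Fin 3))
          (B : EuclideanSpace ℝ (Fin 3) →ₗ[ℝ] EuclideanSpace ℝ (Fin 3)) * (A t).det) t := by
  rw [← hasDerivWithinAt_univ] at hA ⊢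
  exact hasDerivWithinAt_det_of_hasDerivWithinAt_clm_comp hA

/-- **Liouville's formula with vanishing trace, on a convex set of times** (Majda–Bertozzi
Prop. 1.2 with Prop. 1.4 (ii) ⇒ (iii): "`div v = 0`" ⇒ "`J(α, t) = 1`"): if
`A : ℝ → (ℝ³ →L ℝ³)` satisfies `A'(u) = B(u) ∘ A(u)` within a convex set `s ⊆ ℝ` at every
`u ∈ s` (one-sided at endpoints of an interval), and `tr B(u) = 0` on `s`, then `det A` is
constant on `s`. Proof: `(det A)' = tr B det A = 0` within `s` by Jacobi's formula, and the mean
value inequality on the convex set `s`. [cite: MajdaBertozziCUP2002, §1.3 Prop. 1.2 and Prop. 1.4 (p. 13–14)] -/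
theorem det_eq_det_of_hasDerivWithinAt_comp_of_trace_eq_zero
    {A B : ℝ → (EuclideanSpace ℝ (Fin 3) →L[ℝ] EuclideanSpace ℝ (Fin 3))} {s : Set ℝ}
    (hs : Convex ℝ s) (hA : ∀ u ∈ s, HasDerivWithinAt A ((B u).comp (A u)) s u)
    (htr : ∀ u ∈ s, LinearMap.trace ℝ (EuclideanSpace ℝ (Fin 3))
      (B u : EuclideanSpace ℝ (Fin 3) →ₗ[ℝ] EuclideanSpace ℝ (Fin 3)) = 0)
    {u v : ℝ} (hu : u ∈ s) (hv : v ∈ s) : (A u).det = (A v).det := by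
  have hD : ∀ w ∈ s, HasDerivWithinAt (fun w => (A w).det) (0 : ℝ) s w := by
    intro w hw
    have h := hasDerivWithinAt_det_of_hasDerivWithinAt_clm_comp (hA w hw)
    rw [htr w hw, zero_mul] at h
    exact h
  have h := hs.norm_image_sub_le_of_norm_hasDerivWithin_le hD (fun w _ => le_of_eq norm_zero) hu hv
  rw [zero_mul, norm_le_zero_iff, sub_eq_zero] at h
  exact h.symm

/-- **Liouville's formula with vanishing trace on an open interval** (corollary for curves
differentiable in the two-sided sense on `(a, b)`). [cite: MajdaBertozziCUP2002, §1.3 Prop. 1.2 and Prop. 1.4 (p. 13–14)] -/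
theorem det_eq_det_of_hasDerivAt_comp_of_trace_eq_zero
    {A B : ℝ → (EuclideanSpace ℝ (Fin 3) →L[ℝ] EuclideanSpace ℝ (Fin 3))} {a b : ℝ}
    (hA : ∀ u ∈ Ioo a b, HasDerivAt A ((B u).comp (A u)) u)
    (htr : ∀ u ∈ Ioo a b, LinearMap.trace ℝ (EuclideanSpace ℝ (Fin 3))
      (B u : EuclideanSpace ℝ (Fin 3) →ₗ[ℝ] EuclideanSpace ℝ (Fin 3)) = 0)
    {s t : ℝ} (hs : s ∈ Ioo a b) (ht : t ∈ Ioo a b) : (A s).det = (A t).det :=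
  det_eq_det_of_hasDerivWithinAt_comp_of_trace_eq_zero (convex_Ioo a b)
    (fun u hu => (hA u hu).hasDerivWithinAt) htr hs ht

end Literature.Analysis.Calculus
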